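import Mathlib
import Literature.Analysis.ODE.LinearStableSplitting
import Literature.Analysis.ODE.EvolutionMapAutonomous
import Literature.Analysis.ODE.EvolutionMapSmooth
import Literature.Analysis.FluidPDE.ParticleTrajectoryVariation
import Literature.Dynamics.FixedPoints.DominatedUnstableSetNull
import HarnessLib

/-!
# The backward basin of a rest point with a STABLE DIRECTION is Lebesgue-null
# (measure-zero half of the centre-unstable manifold theorem; Teschl §9.1/§3.2 + the dominated cone lemma)

Topic `Literature/Dynamics/FixedPoints`.  Everything is PROVED (no named fact, no definition, no
instance, no `sorry`).  For a `C¹` vector field `F` on `ℝⁿ = EuclideanSpace ℝ n` with `‖DF‖ ≤ K`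
(so the flow `Φ_s = φ(s, 0, ·)` of `ẋ = F(x)` is global, tree `ODE.evolutionMap`) and a zero `z` of `F`
whose linearisation `A = DF(z)` has a stable direction — some `v ≠ 0` with `exp(tA)v → 0` as `t → ∞`,
i.e. an eigenvalue of negative real part (Teschl §3.2 Thm 3.4) — the set
`{y | Φ_{−t} y → z as t → ∞}` of points whose BACKWARD orbit converges to `z` is Lebesgue-null.

Classically this is read off the centre-unstable manifold `W^{cu}(z)` (Kelley 1967; Hirsch–Pugh–Shub
1977, Thm 5.1): it contains every orbit converging to `z` in backward time and has dimension
`dim Eᶜᵘ ≤ n − 1`.  Here it is proved WITHOUT invariant-manifold theory, from two tree results: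

* the linear stable / centre-unstable splitting with rates (`Literature.Analysis.ODE.exists_stableSplitting`,
  Teschl §9.1 (9.2)/(9.4)/(9.5)–(9.6), §3.2 Thm 3.4), in its sampling form
  `exists_dominatedSplitting_exp_of_tendsto_zero`: for `T` large, `exp(TA)` preserves `ℝⁿ = Es ⊕ Ec`,
  `Ec ≠ ⊤`, contracting on `Es` at a rate dominated by its lower rate on `Ec`;
* the dominated cone lemma `Literature.Dynamics.FixedPoints.addHaar_setOf_tendsto_atBot_eq_zero_of_dominated`
  (Robinson Ch. V §5.10.1 / Katok–Hasselblatt §6.2, proved in the tree): for a one-parameter group `Φ`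
  with `Φ_T ∈ C¹` and such a splitting for `D(Φ_T)(z)`, `{y | Φ_s y → z, s → −∞}` is null;

glued by the flow bookkeeping of this file (group law, `Φ_T ∈ C¹`, and `D(Φ_T)(z) = exp(T·DF(z))` at a
rest point — the equation of variation, tree `hasFDerivAt_evolutionMap_linearised`, has the constant
coefficient `DF(z)` along the rest orbit, and its solution from `1` is `exp(sA)`):

* `evolutionMap_add_apply`, `contDiff_evolutionMap_const`, `fderiv_evolutionMap_eq_exp_of_eq_zero`;
* `volume_setOf_tendsto_evolutionMap_neg_eq_zero_of_stableDirection` — **the theorem**, any finite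
  index type `n`, `F ∈ C¹`;
* `unstableSetNull_of_stableDirection` — the `n = 3`, `F ∈ C²` text, VERBATIM the Prop
  `NsregP2.R41.UnstableSetNull` («(IM1)») of the Navier–Stokes §B census (crux `PowerGaugeEulerLiouville`,
  stmt-NavierStokesRegularity-19832, nsreg-p2 ROUND-41 `Sketch41.lean`), which is thereby a THEOREM and
  no longer a named-fact hypothesis of R41's Theorem A (`TheoremAFinite`).

WHAT THIS IS NOT: not a statement about Navier–Stokes or Euler — finite-dimensional ODE / linear algebra.

## Mathlib / tree search

Tree: `Literature/Dynamics/FixedPoints/{UnstableSetNull, HyperbolicUnstableSetNull, DominatedUnstableSetNull,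
StableManifoldTheorem}` (hyperbolic / explicit-dominated-splitting forms; the fact
`Robinson1999_stableManifoldTheorem`), `Summits/…/EulerZoomLiouvillePowerGaugeEulerLiouvilleSelfSimilarDegenerateNodeBasin`
(real block normal form of `DW(z)` in `ℝ³`); none takes the abstract hypothesis «`exp(tA)v → 0` for some
`v ≠ 0`».  Mathlib: `hasDerivAt_exp_smul_const'`, `lipschitzWith_of_nnnorm_fderiv_le`,
`ContDiff.continuous_fderiv` (used); no stable/centre manifold theorem (`lean search 'centerManifold|
centreManifold|stableManifold'`: tree only).

## References

* G. Teschl, *Ordinary Differential Equations and Dynamical Systems*, GSM 140, AMS 2012, §9.1 Thm 9.2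
  (9.4), (9.5)–(9.6) (PDF pp. 264–265); §3.2 Thm 3.4 (PDF p. 82). [Teschl2012]
* C. Robinson, *Dynamical Systems*, 2nd ed., CRC 1999, Ch. V §5.10.1 (cone estimate). [Robinson1999]
* A. Katok, B. Hasselblatt, *Introduction to the Modern Theory of Dynamical Systems*, CUP 1995, §6.2.
  [KatokHasselblatt1995]
* A. Kelley, The stable, center-stable, center, center-unstable, unstable manifolds, J. Differential
  Equations 3 (1967) 546–570 (the classical source of «(IM1)»; not used in the proof).
-/

noncomputable section

namespace Literature.Dynamics.FixedPoints

open MeasureTheory Set Filter Topology Metric Function NormedSpace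
open Literature.Analysis Literature.Analysis.ODE

section Flow

variable {n : Type*} [Fintype n] [DecidableEq n]
variable {F : EuclideanSpace ℝ n → EuclideanSpace ℝ n} {K : ℝ}

omit [DecidableEq n] in
/-- A `C¹` field with `‖DF‖ ≤ K` is globally `K⁺`-Lipschitz. [folklore] -/
private theorem lipschitzWith_of_contDiff_of_norm_fderiv_le (hF : ContDiff ℝ 1 F) (hK : ∀ y, ‖fderiv ℝ F y‖ ≤ K) :
    LipschitzWith (Real.toNNReal K) F := by
  refine lipschitzWith_of_nnnorm_fderiv_le (hF.differentiable one_ne_zero) fun y => ?_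
  rw [← norm_toNNReal]
  exact Real.toNNReal_le_toNNReal (hK y)

omit [DecidableEq n] in
/-- The autonomous field `F` satisfies the Cauchy–Lipschitz hypotheses on the time set `univ`. [folklore] -/
private theorem isUniformlyLipschitzOn_const_of_norm_fderiv_le (hF : ContDiff ℝ 1 F) (hK : ∀ y, ‖fderiv ℝ F y‖ ≤ K) :
    ODE.IsUniformlyLipschitzOn (fun _ : ℝ => F) univ :=
  ODE.IsUniformlyLipschitzOn.of_lipschitzWith (fun _ => continuousOn_const)
    fun _ _ => lipschitzWith_of_contDiff_of_norm_fderiv_le hF hK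

omit [DecidableEq n] in
/-- `Φ₀ = id` for the flow `Φ_s = φ(s, 0, ·)` of `F` (Teschl Thm 6.1 (6.11), first clause). [cite: Teschl2012, §6.2 Thm 6.1 eq. (6.11) (PDF p. 200)] -/
theorem evolutionMap_zero_apply (y : EuclideanSpace ℝ n) :
    ODE.evolutionMap (fun _ : ℝ => F) 0 0 y = y :=
  ODE.evolutionMap_self _ _ _

omit [DecidableEq n] in
/-- **Group law** `Φ_{s+t} = Φ_s ∘ Φ_t` for the (global) flow of an autonomous `C¹` field with
`‖DF‖ ≤ K` (Teschl Thm 6.1: "`Φ(t + s, x) = Φ(t, Φ(s, x))`" (6.10)–(6.11)). [cite: Teschl2012, §6.2 Thm 6.1 eqs. (6.10)–(6.11) (PDF p. 200)] -/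
theorem evolutionMap_add_apply (hF : ContDiff ℝ 1 F) (hK : ∀ y, ‖fderiv ℝ F y‖ ≤ K) (s t : ℝ)
    (y : EuclideanSpace ℝ n) :
    ODE.evolutionMap (fun _ : ℝ => F) 0 (s + t) y =
      ODE.evolutionMap (fun _ : ℝ => F) 0 s (ODE.evolutionMap (fun _ : ℝ => F) 0 t y) := by
  have hL := isUniformlyLipschitzOn_const_of_norm_fderiv_le hF hK
  have h1 := ODE.evolutionMap_const_eq_evolutionMap_zero (lipschitzWith_of_contDiff_of_norm_fderiv_le hF hK)
    t (t + s) (ODE.evolutionMap (fun _ : ℝ => F) 0 t y)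
  rw [add_sub_cancel_left] at h1
  rw [← h1, hL.evolutionMap_trans convex_univ (mem_univ _) (mem_univ _) (mem_univ _), add_comm]

omit [DecidableEq n] in
/-- A zero of `F` ("fixed point", Teschl §6.2: "A point `x₀` with `f(x₀) = 0` is called a fixed point")
is a rest point of the flow: `Φ_s z = z`. [cite: Teschl2012, §6.2 (PDF p. 201, definition of a fixed point) with Thm 6.1 (PDF p. 200)] -/
theorem evolutionMap_apply_eq_self_of_eq_zero (hF : ContDiff ℝ 1 F) (hK : ∀ y, ‖fderiv ℝ F y‖ ≤ K)
    {z : EuclideanSpace ℝ n} (hz : F z = 0) (s : ℝ) : ODE.evolutionMap (fun _ : ℝ => F) 0 s z = z :=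
  (isUniformlyLipschitzOn_const_of_norm_fderiv_le hF hK).evolutionMap_eq_self_of_forall_eq_zero convex_univ
    (fun _ _ => hz) (mem_univ _) (mem_univ _)

omit [DecidableEq n] in
/-- Each time-`s` map of the flow of a `C¹` field with bounded derivative is `C¹` (Teschl Thm 2.10 /
Thm 6.1: `Φ ∈ C^k`). [cite: Teschl2012, §2.4 Thm 2.10 (PDF p. 57); §6.2 Thm 6.1 (PDF p. 200)] -/
theorem contDiff_evolutionMap_const (hF : ContDiff ℝ 1 F) (hK : ∀ y, ‖fderiv ℝ F y‖ ≤ K) (s : ℝ) :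
    ContDiff ℝ 1 (ODE.evolutionMap (fun _ : ℝ => F) 0 s) := by
  have hL := isUniformlyLipschitzOn_const_of_norm_fderiv_le hF hK
  have hW : ContDiffOn ℝ 1 (uncurry fun _ : ℝ => F) (univ ×ˢ univ) :=
    (hF.comp contDiff_snd).contDiffOn
  exact hL.contDiff_evolutionMap convex_univ uniqueDiffOn_univ le_rfl hW (mem_univ (0 : ℝ)) (mem_univ s)

omit [DecidableEq n] in
/-- **The derivative of the flow at a rest point is the exponential of the linearisation**:
`D(Φ_T)(z) = exp(T·DF(z))` when `F z = 0` (the equation of variation at a rest point has constant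
coefficient `DF(z)`: Teschl's first variational equation (2.49) `ẏ = A(t,x) y`,
`A(t,x) = ∂f/∂x(t, φ(t,t₀,x))`, with `φ(t, t₀, z) ≡ z`, solved by the matrix exponential (3.6)).
[cite: Teschl2012, §2.4 eq. (2.49) and Thm 2.10 (PDF p. 57); §3.1 eq. (3.6) (PDF p. 71)] -/
theorem fderiv_evolutionMap_eq_exp_of_eq_zero (hF : ContDiff ℝ 1 F) (hK : ∀ y, ‖fderiv ℝ F y‖ ≤ K)
    {z : EuclideanSpace ℝ n} (hz : F z = 0) (T : ℝ) :
    fderiv ℝ (ODE.evolutionMap (fun _ : ℝ => F) 0 T) z = exp (T • fderiv ℝ F z) := by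
  have hL := isUniformlyLipschitzOn_const_of_norm_fderiv_le hF hK
  have hd : ∀ s ∈ (univ : Set ℝ), Differentiable ℝ ((fun _ : ℝ => F) s) := fun _ _ => hF.differentiable one_ne_zero
  have hA : ContinuousOn (fun p : ℝ × EuclideanSpace ℝ n => fderiv ℝ ((fun _ : ℝ => F) p.1) p.2) (univ ×ˢ univ) :=
    ((hF.continuous_fderiv one_ne_zero).comp continuous_snd).continuousOn
  have hder := Literature.Analysis.FluidPDE.hasFDerivAt_evolutionMap_linearised hL convex_univ hd hA
    (mem_univ (0 : ℝ)) (mem_univ T) z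
  rw [hder.fderiv]
  -- the linearised field along the rest point is the constant field `B ↦ DF(z) ∘ B`
  set A : EuclideanSpace ℝ n →L[ℝ] EuclideanSpace ℝ n := fderiv ℝ F z with hAdef
  have hrest : ∀ s : ℝ, ODE.evolutionMap (fun _ : ℝ => F) 0 s z = z :=
    evolutionMap_apply_eq_self_of_eq_zero hF hK hz
  have hW : (fun (s : ℝ) (B : EuclideanSpace ℝ n →L[ℝ] EuclideanSpace ℝ n) =>
      (fderiv ℝ ((fun _ : ℝ => F) s) (ODE.evolutionMap (fun _ : ℝ => F) 0 s z)).comp B) =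
      fun (_ : ℝ) (B : EuclideanSpace ℝ n →L[ℝ] EuclideanSpace ℝ n) => A.comp B := by
    funext s B
    simp only [hrest s, hAdef]
  rw [hW]
  -- the solution of `B' = A ∘ B`, `B(0) = 1` is `exp(sA)`
  have hlip : ∀ s ∈ uIcc (0 : ℝ) T, LipschitzWith ‖A‖₊
      ((fun (_ : ℝ) (B : EuclideanSpace ℝ n →L[ℝ] EuclideanSpace ℝ n) => A.comp B) s) := by
    intro s _
    refine LipschitzWith.of_dist_le_mul fun B B' => ?_
    rw [dist_eq_norm, dist_eq_norm, ← ContinuousLinearMap.comp_sub, coe_nnnorm]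
    exact A.opNorm_comp_le (B - B')
  have hsol : ∀ s ∈ uIcc (0 : ℝ) T, HasDerivWithinAt (fun u : ℝ => exp (u • A))
      (((fun (_ : ℝ) (B : EuclideanSpace ℝ n →L[ℝ] EuclideanSpace ℝ n) => A.comp B) s) (exp (s • A)))
      (uIcc (0 : ℝ) T) s := by
    intro s _
    exact (hasDerivAt_exp_smul_const' (𝕂 := ℝ) A s).hasDerivWithinAt
  have h := ODE.evolutionMap_eq_of_hasDerivWithinAt hlip hsol (s := T) right_mem_uIcc
  have h0 : (0 : ℝ) • A = 0 := zero_smul ℝ A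
  have h1 : exp ((0 : ℝ) • A) = (1 : EuclideanSpace ℝ n →L[ℝ] EuclideanSpace ℝ n) := by
    rw [h0, exp_zero]
  simp only [h1] at h
  exact h

end Flow

section Basin

variable {n : Type*} [Fintype n] [DecidableEq n]

/-- **The backward basin of a rest point with a stable direction is Lebesgue-null.**  Let `F` be a
`C¹` vector field on `ℝⁿ` with `‖DF‖ ≤ K` (global flow `Φ`), `F z = 0`, and suppose the linearisation
`DF(z)` has a STABLE DIRECTION: `exp(t·DF(z)) v → 0` as `t → ∞` for some `v ≠ 0` (equivalently, an
eigenvalue of negative real part).  Then the set of points whose backward `F`-orbit converges to `z` has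
Lebesgue measure zero.  Proof: by the linear stable splitting (Teschl §9.1/§3.2, tree
`exists_dominatedSplitting_exp_of_tendsto_zero`) the time-`T` map `Φ_T`, whose derivative at `z` is
`exp(T·DF(z))`, has a dominated splitting with a nontrivial strictly contracting part for `T` large, so
the dominated cone lemma (Robinson Ch. V §5.10.1 / Katok–Hasselblatt §6.2, tree
`addHaar_setOf_tendsto_atBot_eq_zero_of_dominated`) applies.  This is the measure-zero half of the
centre-unstable manifold theorem (Kelley 1967; Hirsch–Pugh–Shub 1977 Thm 5.1) in the form requested by
the Navier–Stokes §B crux `PowerGaugeEulerLiouville` (stmt-NavierStokesRegularity-19832, R41 «(IM1)»,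
`UnstableSetNull`), proved without invariant-manifold theory.
[cite: Teschl2012, §9.1 Thm 9.2 eq. (9.4), (9.5)–(9.6), §3.2 Thm 3.4 (PDF pp. 82, 264–265); Robinson1999, Ch. V §5.10.1 (cone estimate, dominated form; proved in the tree)] -/
theorem volume_setOf_tendsto_evolutionMap_neg_eq_zero_of_stableDirection
    (F : EuclideanSpace ℝ n → EuclideanSpace ℝ n) (K : ℝ) (z : EuclideanSpace ℝ n)
    (hF : ContDiff ℝ 1 F) (hK : ∀ y, ‖fderiv ℝ F y‖ ≤ K) (hz : F z = 0)
    (hv : ∃ v : EuclideanSpace ℝ n, v ≠ 0 ∧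
      Tendsto (fun t : ℝ => exp (t • fderiv ℝ F z) v) atTop (𝓝 0)) :
    volume {y : EuclideanSpace ℝ n |
      Tendsto (fun t : ℝ => ODE.evolutionMap (fun _ : ℝ => F) 0 (-t) y) atTop (𝓝 z)} = 0 := by
  obtain ⟨v, hv0, hv⟩ := hv
  obtain ⟨Es, Ec, T, a, b, hcompl, hT, ha1, hab, hEc, hEs', hEc', hrs, hrc⟩ :=
    exists_dominatedSplitting_exp_of_tendsto_zero (fderiv ℝ F z) hv0 hv
  have hexp := fderiv_evolutionMap_eq_exp_of_eq_zero hF hK hz T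
  have hnull := addHaar_setOf_tendsto_atBot_eq_zero_of_dominated volume
    (Φ := ODE.evolutionMap (fun _ : ℝ => F) 0) evolutionMap_zero_apply (evolutionMap_add_apply hF hK)
    hT (contDiff_evolutionMap_const hF hK T) (p := z) hcompl
    (fun x hx => by rw [hexp]; exact hEs' x hx) (fun x hx => by rw [hexp]; exact hEc' x hx) ha1 hab
    (fun x hx => by rw [hexp]; exact hrs x hx) (fun x hx => by rw [hexp]; exact hrc x hx) hEc
  refine measure_mono_null (fun y hy => ?_) hnull
  -- backward convergence along `t ↦ Φ_{−t}` is convergence of `s ↦ Φ_s` along `atBot`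
  have h := (hy : Tendsto (fun t : ℝ => ODE.evolutionMap (fun _ : ℝ => F) 0 (-t) y) atTop (𝓝 z)).comp
    tendsto_neg_atBot_atTop
  refine h.congr fun s => ?_
  simp only [Function.comp_apply, neg_neg]

/-- **(IM1) of the Navier–Stokes §B census, verbatim** (`NsregP2.R41.UnstableSetNull`, Sketch41 of
nsreg-p2 ROUND-41; [Kelley1967], [Hirsch–Pugh–Shub 1977, Thm 5.1] there): for a `C²` field `F` on `ℝ³`
with bounded derivative, a zero `z` of `F` at which the linearisation has a stable direction, the set of
points whose backward `F`-orbit converges to `z` has Lebesgue measure zero — the `n = 3`, `C²` case of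
`volume_setOf_tendsto_evolutionMap_neg_eq_zero_of_stableDirection`.
[cite: Teschl2012, §9.1 Thm 9.2, §3.2 Thm 3.4 (PDF pp. 82, 264–265); Robinson1999, Ch. V §5.10.1 (cone estimate; proved in the tree)] -/
theorem unstableSetNull_of_stableDirection :
    ∀ (F : EuclideanSpace ℝ (Fin 3) → EuclideanSpace ℝ (Fin 3)) (K : ℝ) (z : EuclideanSpace ℝ (Fin 3)),
      ContDiff ℝ 2 F → (∀ y, ‖fderiv ℝ F y‖ ≤ K) → F z = 0 →
      (∃ v : EuclideanSpace ℝ (Fin 3), v ≠ 0 ∧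
          Tendsto (fun t : ℝ => NormedSpace.exp (t • fderiv ℝ F z) v) atTop (𝓝 0)) →
      volume {y : EuclideanSpace ℝ (Fin 3) |
          Tendsto (fun t : ℝ => ODE.evolutionMap (fun _ : ℝ => F) 0 (-t) y) atTop (𝓝 z)} = 0 :=
  fun F K z hF hK hz hv =>
    volume_setOf_tendsto_evolutionMap_neg_eq_zero_of_stableDirection F K z (hF.of_le (by norm_num)) hK hz hv

end Basin

end Literature.Dynamics.FixedPoints

end
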